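import Literature.NumberTheory.Automorphic.BianchiBoundaryBorel
import Literature.NumberTheory.Automorphic.BorelGoodPlaceModel
import Literature.NumberTheory.Automorphic.CuspidalCohomologyGLShapiro
import Literature.NumberTheory.Automorphic.StrongApproximationGL2
import Literature.NumberTheory.Automorphic.IdeleIdealClass
import HarnessLib

/-!
# Stabilisers of the Borel subgroup `B(F)` on `GL₂(𝔸_F^∞) / K_f(𝔫)` at a neat level are lattices

Topic `NumberTheory/Automorphic`; namespace `Literature.NumberTheory.Automorphic`, grouping
sub-namespaces `BigHeckeGLn` (the finite principal congruence level `K_f(𝔫)`) and `ParallelWeight`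
(the Borel subgroup `borel F` of `BianchiBoundaryBorel`).  Theorems only.

For a number field `F`, a non-zero ideal `𝔫 ⊆ 𝓞_F`, a diagonal finite idele
`d = diag(t₀, t₁)`, `tᵢ ∈ (𝔸_F^∞)ˣ`, and `c ∈ GL₂(𝒪̂_F)`, the stabiliser in `B(F)` of the point
`x₀ = d c K_f(𝔫) ∈ GL₂(𝔸_F^∞) / K_f(𝔫)` is `{γ : d⁻¹ γ d ∈ K_f(𝔫)}` (`K_f(𝔫)` is normal in
`GL₂(𝒪̂_F)`, `conj_mem_comap_principalCongruenceLevel`).  If `𝔫` is NEAT — no `a ∈ F` with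
`a, a⁻¹` everywhere integral and `a ≡ 1 (mod 𝔫)` other than `a = 1` — then
(`mem_orbitStabilizer_borel_iff`)

  `γ = (a b; 0 e) ∈ Stab_{B(F)}(x₀) ↔ a = e = 1 ∧ |b|_v ≤ |𝔫|_v |t₀|_v / |t₁|_v for all v`,

i.e. the stabiliser is the group of unipotent matrices `n(β)`, `β` in the valuation box (a
fractional ideal) `Λ_t = {β ∈ F : |β|_v ≤ |𝔫|_v |t₀|_v |t₁|_v⁻¹}`, whose bounds are non-zero and
equal to `1` for almost all `v` (`borelBoxRadius_ne_zero`, `borelBoxRadius_eventually_eq_one`).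
With `ValuationBoxLattice`, `SandwichedLattice` and `FreeAbelianRankTwoCohomology` this makes the
stabilisers free abelian of rank `[F : ℚ]` with finitely generated cohomology (sibling file).
[cite: Harder1987, §2]

## References

* G. Harder, *Eisenstein cohomology of arithmetic groups. The case GL₂*, Invent. Math. 89 (1987), §2
  [Harder1987].
* G. Shimura, *Introduction to the arithmetic theory of automorphic functions* (1971), Ch. 3
  [ShimuraIATAF1971].
-/

noncomputable section

open scoped NumberField
open IsDedekindDomain

namespace Literature.NumberTheory.Automorphic

/-! ### The finite principal congruence level `K_f(𝔫)`: local membership, normality -/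

namespace BigHeckeGLn

variable {n : ℕ} {K : Type} [Field K] [NumberField K]

/-- `k ∈ GL_n(𝒪̂)` iff all its local components (and those of `k⁻¹`) are integral. [folklore] -/
theorem mem_glFiniteIntegralLevel_iff_localComponent {k : FiniteAdelicGL n K} :
    k ∈ glFiniteIntegralLevel n K ↔ ∀ v : HeightOneSpectrum (𝓞 K),
      localComponent n K v k ∈
        valuedCongruenceSubgroup (Fin n) (1 : WithZero (Multiplicative ℤ)) := by
  refine ⟨fun hk v => localComponent_mem_valuedCongruenceSubgroup_one hk v, fun h => ?_⟩
  rw [mem_glFiniteIntegralLevel_iff]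
  refine ⟨fun i j => mem_integralFiniteAdeles_iff.2 fun v => ?_,
    fun i j => mem_integralFiniteAdeles_iff.2 fun v => ?_⟩
  · rw [HeightOneSpectrum.mem_adicCompletionIntegers, ← coe_localComponent_apply]
    exact (mem_valuedCongruenceSubgroup_iff.1 (h v)).1 i j
  · rw [HeightOneSpectrum.mem_adicCompletionIntegers, ← coe_localComponent_apply, map_inv]
    exact (mem_valuedCongruenceSubgroup_iff.1 (h v)).2.1 i j

/-- **Membership in `K_f(𝔫)` is local**: `k ∈ K_f(𝔫)` iff `k_v ∈ K_v(|𝔫|_v)` for every `v`.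
[cite: ShimuraIATAF1971, Ch. 3] -/
theorem mem_comap_principalCongruenceLevel_iff_localComponent {𝔫 : Ideal (𝓞 K)}
    {k : FiniteAdelicGL n K} :
    k ∈ (principalCongruenceLevel n K 𝔫).comap (GLn.ofFinite n K) ↔
      ∀ v : HeightOneSpectrum (𝓞 K), localComponent n K v k ∈
        valuedCongruenceSubgroup (Fin n) (idealRadius K v 𝔫) := by
  rw [Subgroup.mem_comap, mem_principalCongruenceLevel_iff, mem_glIntegralLevel_iff,
    GLn.sndHom_ofFinite, GLn.fstHom_ofFinite]
  have hloc : ∀ v, (AdelicGroupData.gl n K).toLocal v (GLn.ofFinite n K k) = localComponent n K v k :=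
    fun v => by rw [← localComponent_sndHom, GLn.sndHom_ofFinite]
  refine ⟨fun h v => ?_, fun h => ⟨⟨?_, rfl⟩, fun v => ?_⟩⟩
  · rw [← hloc]; exact h.2 v
  · exact mem_glFiniteIntegralLevel_iff_localComponent.2 fun v =>
      valuedCongruenceSubgroup_mono _ (idealRadius_le_one' (K := K) v 𝔫) (h v)
  · rw [hloc]; exact h v

/-- Conjugating an element of `K_v(r)`, `r ≤ 1`, by an element of `GL_n(𝒪_v)` stays in `K_v(r)`.
[folklore] -/
theorem conj_mem_valuedCongruenceSubgroup {L : Type*} [Field L] {Γ₀ : Type*}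
    [LinearOrderedCommGroupWithZero Γ₀] [Valued L Γ₀] {m : Type*} [Fintype m] [DecidableEq m]
    {r : Γ₀} (hr : r ≤ 1) {c k : GL m L} (hc : c ∈ valuedCongruenceSubgroup m (1 : Γ₀))
    (hk : k ∈ valuedCongruenceSubgroup m r) : c * k * c⁻¹ ∈ valuedCongruenceSubgroup m r := by
  obtain ⟨hc₁, hc₂, -⟩ := hc
  obtain ⟨hk₁, hk₂, hk₃⟩ := hk
  have hck : c * k * c⁻¹ ∈ valuedCongruenceSubgroup m (1 : Γ₀) :=
    mul_mem (mul_mem ⟨hc₁, hc₂, fun i j => ?g1⟩ (valuedCongruenceSubgroup_mono _ hr ⟨hk₁, hk₂, hk₃⟩))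
      (inv_mem ⟨hc₁, hc₂, fun i j => ?g2⟩)
  case g1 | g2 =>
    rw [Matrix.sub_apply]
    refine Valued.v.map_sub_le (hc₁ i j) ?_
    rw [Matrix.one_apply]; split_ifs <;> simp
  refine ⟨hck.1, hck.2.1, fun i j => ?_⟩
  have hconj : ((c * k * c⁻¹ : GL m L) : Matrix m m L) - 1 =
      (c : Matrix m m L) * ((k : Matrix m m L) - 1) * ((c⁻¹ : GL m L) : Matrix m m L) := by
    rw [Matrix.mul_sub, Matrix.sub_mul, Matrix.mul_one, Units.val_mul, Units.val_mul,
      ← Units.val_mul c c⁻¹, mul_inv_cancel, Units.val_one]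
  rw [hconj]
  have h1 := valued_mul_apply_le m hc₁ hk₃
  have h2 := valued_mul_apply_le m h1 hc₂ i j
  simpa using h2

/-- **`K_f(𝔫)` is normal in `GL_n(𝒪̂)`**: `c k c⁻¹ ∈ K_f(𝔫)` for `c ∈ GL_n(𝒪̂)`, `k ∈ K_f(𝔫)`.
[cite: ShimuraIATAF1971, Ch. 3] -/
theorem conj_mem_comap_principalCongruenceLevel {𝔫 : Ideal (𝓞 K)} {c k : FiniteAdelicGL n K}
    (hc : c ∈ glFiniteIntegralLevel n K)
    (hk : k ∈ (principalCongruenceLevel n K 𝔫).comap (GLn.ofFinite n K)) :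
    c * k * c⁻¹ ∈ (principalCongruenceLevel n K 𝔫).comap (GLn.ofFinite n K) := by
  rw [mem_comap_principalCongruenceLevel_iff_localComponent] at hk ⊢
  intro v
  rw [map_mul, map_mul, map_inv]
  exact conj_mem_valuedCongruenceSubgroup (idealRadius_le_one' (K := K) v 𝔫)
    (localComponent_mem_valuedCongruenceSubgroup_one hc v) (hk v)

/-- `(d c)⁻¹ g (d c) ∈ K_f(𝔫) ↔ d⁻¹ g d ∈ K_f(𝔫)` for `c ∈ GL_n(𝒪̂)`. [folklore] -/
theorem inv_mul_mul_mem_comap_principalCongruenceLevel_iff {𝔫 : Ideal (𝓞 K)}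
    {c : FiniteAdelicGL n K} (hc : c ∈ glFiniteIntegralLevel n K) (d g : FiniteAdelicGL n K) :
    (d * c)⁻¹ * g * (d * c) ∈ (principalCongruenceLevel n K 𝔫).comap (GLn.ofFinite n K) ↔
      d⁻¹ * g * d ∈ (principalCongruenceLevel n K 𝔫).comap (GLn.ofFinite n K) := by
  have heq : (d * c)⁻¹ * g * (d * c) = c⁻¹ * (d⁻¹ * g * d) * c⁻¹⁻¹ := by
    rw [inv_inv]; group
  rw [heq]
  refine ⟨fun h => ?_, fun h => conj_mem_comap_principalCongruenceLevel (inv_mem hc) h⟩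
  have := conj_mem_comap_principalCongruenceLevel hc h
  rwa [show c * (c⁻¹ * (d⁻¹ * g * d) * c⁻¹⁻¹) * c⁻¹ = d⁻¹ * g * d by rw [inv_inv]; group] at this

/-- `|𝔫|_v = 1` for almost all `v` (`𝔫 ≠ 0`). [folklore] -/
theorem idealRadius_eventually_eq_one {𝔫 : Ideal (𝓞 K)} (h𝔫 : 𝔫 ≠ 0) :
    ∀ᶠ v : HeightOneSpectrum (𝓞 K) in Filter.cofinite, idealRadius K v 𝔫 = 1 := by
  refine (Ideal.finite_factors h𝔫).subset fun v hv => ?_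
  by_contra hdvd
  exact hv (idealRadius_eq_one_of_not_dvd h𝔫 hdvd)

/-! ### Conjugating a global matrix by a diagonal finite idele -/

/-- Entries of `d⁻¹ ι(γ) d`, `d = diag(t)`: `tᵢ⁻¹ γᵢⱼ tⱼ`. [folklore] -/
theorem coe_glDiagonal_inv_mul_globalEmbedding_mul_glDiagonal_apply
    (t : Fin n → (FiniteAdeleRing (𝓞 K) K)ˣ) (γ : GL (Fin n) K) (i j : Fin n) :
    (((glDiagonal n (FiniteAdeleRing (𝓞 K) K) t)⁻¹ * globalEmbedding n K γ *
        glDiagonal n (FiniteAdeleRing (𝓞 K) K) t : FiniteAdelicGL n K) :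
        Matrix (Fin n) (Fin n) (FiniteAdeleRing (𝓞 K) K)) i j =
      ((t i)⁻¹ : (FiniteAdeleRing (𝓞 K) K)ˣ) *
        algebraMap K (FiniteAdeleRing (𝓞 K) K) ((γ : Matrix (Fin n) (Fin n) K) i j) * t j := by
  rw [← map_inv, Units.val_mul, Units.val_mul, coe_glDiagonal, coe_glDiagonal,
    Matrix.mul_diagonal, Matrix.diagonal_mul]
  rfl

/-- `(d⁻¹ g d)⁻¹ = d⁻¹ g⁻¹ d`. [folklore] -/
theorem conj_inv_eq {G : Type*} [Group G] (d g : G) : (d⁻¹ * g * d)⁻¹ = d⁻¹ * g⁻¹ * d := by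
  group

/-- The valuation of the `v`-component of the inverse of a finite idele. [folklore] -/
theorem valued_units_inv_apply (u : (FiniteAdeleRing (𝓞 K) K)ˣ) (v : HeightOneSpectrum (𝓞 K)) :
    Valued.v (((u⁻¹ : (FiniteAdeleRing (𝓞 K) K)ˣ) : FiniteAdeleRing (𝓞 K) K) v) =
      (Valued.v ((u : FiniteAdeleRing (𝓞 K) K) v))⁻¹ := by
  have h := congrArg Valued.v (FiniteAdeleRing.val_apply_mul_inv_apply (R := 𝓞 K) (K := K) u v)
  rw [map_mul, map_one] at h
  exact (eq_inv_of_mul_eq_one_right h)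

/-- **Local entries of `d⁻¹ ι(γ) d`**: `|(d⁻¹ ι(γ) d)_{ij}|_v = |tᵢ|_v⁻¹ |γᵢⱼ|_v |tⱼ|_v`. [folklore] -/
theorem valued_localComponent_conj_apply (t : Fin n → (FiniteAdeleRing (𝓞 K) K)ˣ)
    (γ : GL (Fin n) K) (v : HeightOneSpectrum (𝓞 K)) (i j : Fin n) :
    Valued.v ((localComponent n K v ((glDiagonal n (FiniteAdeleRing (𝓞 K) K) t)⁻¹ *
        globalEmbedding n K γ * glDiagonal n (FiniteAdeleRing (𝓞 K) K) t) :
        Matrix (Fin n) (Fin n) (v.adicCompletion K)) i j) =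
      (Valued.v (((t i : (FiniteAdeleRing (𝓞 K) K)ˣ) : FiniteAdeleRing (𝓞 K) K) v))⁻¹ *
        v.valuation K ((γ : Matrix (Fin n) (Fin n) K) i j) *
        Valued.v (((t j : (FiniteAdeleRing (𝓞 K) K)ˣ) : FiniteAdeleRing (𝓞 K) K) v) := by
  rw [coe_localComponent_apply, coe_glDiagonal_inv_mul_globalEmbedding_mul_glDiagonal_apply]
  change Valued.v ((((t i)⁻¹ : (FiniteAdeleRing (𝓞 K) K)ˣ) : FiniteAdeleRing (𝓞 K) K) v *
    algebraMap K (FiniteAdeleRing (𝓞 K) K) ((γ : Matrix (Fin n) (Fin n) K) i j) v *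
    ((t j : (FiniteAdeleRing (𝓞 K) K)ˣ) : FiniteAdeleRing (𝓞 K) K) v) = _
  rw [map_mul, map_mul, valued_units_inv_apply, IsDedekindDomain.FiniteAdeleRing.algebraMap_apply,
    HeightOneSpectrum.valuedAdicCompletion_eq_valuation']

/-- Diagonal entries of `d⁻¹ ι(γ) d - 1` at `v`: `|γᵢᵢ - 1|_v`. [folklore] -/
theorem valued_localComponent_conj_sub_one_apply_diag (t : Fin n → (FiniteAdeleRing (𝓞 K) K)ˣ)
    (γ : GL (Fin n) K) (v : HeightOneSpectrum (𝓞 K)) (i : Fin n) :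
    Valued.v (((localComponent n K v ((glDiagonal n (FiniteAdeleRing (𝓞 K) K) t)⁻¹ *
        globalEmbedding n K γ * glDiagonal n (FiniteAdeleRing (𝓞 K) K) t) :
        Matrix (Fin n) (Fin n) (v.adicCompletion K)) - 1) i i) =
      v.valuation K ((γ : Matrix (Fin n) (Fin n) K) i i - 1) := by
  rw [Matrix.sub_apply, Matrix.one_apply_eq, coe_localComponent_apply,
    coe_glDiagonal_inv_mul_globalEmbedding_mul_glDiagonal_apply]
  have hcomm : (((t i)⁻¹ : (FiniteAdeleRing (𝓞 K) K)ˣ) : FiniteAdeleRing (𝓞 K) K) *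
      algebraMap K (FiniteAdeleRing (𝓞 K) K) ((γ : Matrix (Fin n) (Fin n) K) i i) * (t i) =
      algebraMap K (FiniteAdeleRing (𝓞 K) K) ((γ : Matrix (Fin n) (Fin n) K) i i) := by
    rw [mul_comm, ← mul_assoc, Units.mul_inv, one_mul]
  rw [hcomm]
  change Valued.v (algebraMap K (FiniteAdeleRing (𝓞 K) K) ((γ : Matrix (Fin n) (Fin n) K) i i) v - 1) = _
  rw [IsDedekindDomain.FiniteAdeleRing.algebraMap_apply, ← HeightOneSpectrum.valuedAdicCompletion_eq_valuation']
  congr 1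
  symm
  refine eq_sub_of_add_eq ?_
  rw [← HeightOneSpectrum.adicCompletion.coe_one, ← HeightOneSpectrum.adicCompletion.coe_add,
    sub_add_cancel]

/-- Off-diagonal entries of `d⁻¹ ι(γ) d - 1` are those of `d⁻¹ ι(γ) d`. [folklore] -/
theorem localComponent_conj_sub_one_apply_of_ne {x : FiniteAdelicGL n K}
    (v : HeightOneSpectrum (𝓞 K)) {i j : Fin n} (hij : i ≠ j) :
    ((localComponent n K v x : Matrix (Fin n) (Fin n) (v.adicCompletion K)) - 1) i j =
      (localComponent n K v x : Matrix (Fin n) (Fin n) (v.adicCompletion K)) i j := by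
  rw [Matrix.sub_apply, Matrix.one_apply_ne hij, sub_zero]

end BigHeckeGLn

/-! ### Stabilisers of the Borel on `GL₂(𝔸_F^∞) / K_f(𝔫)` -/

namespace ParallelWeight

open BigHeckeGLn

variable {F : Type} [Field F] [NumberField F]

omit [NumberField F] in
/-- Inverse entries of an upper triangular `γ = (a b; 0 e) ∈ GL₂(F)`: `γ⁻¹ = (a⁻¹ * ; 0 e⁻¹)`.
[folklore] -/
theorem borel_inv_apply (γ : borel F) :
    (((γ⁻¹ : borel F) : GL (Fin 2) F) : Matrix (Fin 2) (Fin 2) F) 1 0 = 0 ∧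
      (((γ⁻¹ : borel F) : GL (Fin 2) F) : Matrix (Fin 2) (Fin 2) F) 0 0 =
        (((γ : GL (Fin 2) F) : Matrix (Fin 2) (Fin 2) F) 0 0)⁻¹ ∧
      (((γ⁻¹ : borel F) : GL (Fin 2) F) : Matrix (Fin 2) (Fin 2) F) 1 1 =
        (((γ : GL (Fin 2) F) : Matrix (Fin 2) (Fin 2) F) 1 1)⁻¹ := by
  have h10 : (((γ : borel F) : GL (Fin 2) F) : Matrix (Fin 2) (Fin 2) F) 1 0 = 0 :=
    (mem_borel_iff _).1 γ.2
  have hi10 : (((γ⁻¹ : borel F) : GL (Fin 2) F) : Matrix (Fin 2) (Fin 2) F) 1 0 = 0 :=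
    (mem_borel_iff _).1 (γ⁻¹).2
  have hmul : (((γ : GL (Fin 2) F) : Matrix (Fin 2) (Fin 2) F) *
      (((γ⁻¹ : borel F) : GL (Fin 2) F) : Matrix (Fin 2) (Fin 2) F)) = 1 := by
    rw [Subgroup.coe_inv, ← Units.val_mul, mul_inv_cancel, Units.val_one]
  have hmul' : ((((γ⁻¹ : borel F) : GL (Fin 2) F) : Matrix (Fin 2) (Fin 2) F) *
      ((γ : GL (Fin 2) F) : Matrix (Fin 2) (Fin 2) F)) = 1 := by
    rw [Subgroup.coe_inv, ← Units.val_mul, inv_mul_cancel, Units.val_one]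
  have h00 := congrFun (congrFun hmul 0) 0
  have h11 := congrFun (congrFun hmul' 1) 1
  rw [Matrix.mul_apply, Fin.sum_univ_two, Matrix.one_apply_eq, hi10, mul_zero, add_zero] at h00
  rw [Matrix.mul_apply, Fin.sum_univ_two, Matrix.one_apply_eq, hi10, zero_mul, zero_add] at h11
  exact ⟨hi10, eq_inv_of_mul_eq_one_right h00, eq_inv_of_mul_eq_one_left h11⟩

omit [NumberField F] in
/-- An upper triangular matrix with unit diagonal `1` is `n(b)`. [folklore] -/
theorem coe_eq_upperRightHom_of_diag_eq_one (γ : borel F)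
    (h00 : (((γ : GL (Fin 2) F) : Matrix (Fin 2) (Fin 2) F) 0 0) = 1)
    (h11 : (((γ : GL (Fin 2) F) : Matrix (Fin 2) (Fin 2) F) 1 1) = 1) :
    (γ : GL (Fin 2) F) = Matrix.GeneralLinearGroup.upperRightHom
      ((((γ : GL (Fin 2) F) : Matrix (Fin 2) (Fin 2) F) 0 1)) := by
  have h10 : (((γ : borel F) : GL (Fin 2) F) : Matrix (Fin 2) (Fin 2) F) 1 0 = 0 :=
    (mem_borel_iff _).1 γ.2
  ext i j
  rw [Matrix.GeneralLinearGroup.upperRightHom_apply]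
  fin_cases i <;> fin_cases j <;> simp [h00, h11, h10]

/-- The radii `|𝔫|_v |t₀|_v |t₁|_v⁻¹` of the box `Λ_t` of the stabiliser at `diag(t₀, t₁) c`.
[cite: Harder1987, §2] -/
def borelBoxRadius (𝔫 : Ideal (𝓞 F)) (t : Fin 2 → (FiniteAdeleRing (𝓞 F) F)ˣ)
    (v : HeightOneSpectrum (𝓞 F)) : WithZero (Multiplicative ℤ) :=
  idealRadius F v 𝔫 * Valued.v (((t 0 : (FiniteAdeleRing (𝓞 F) F)ˣ) : FiniteAdeleRing (𝓞 F) F) v) *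
    (Valued.v (((t 1 : (FiniteAdeleRing (𝓞 F) F)ˣ) : FiniteAdeleRing (𝓞 F) F) v))⁻¹

/-- The radii are non-zero. [folklore] -/
theorem borelBoxRadius_ne_zero (𝔫 : Ideal (𝓞 F)) (t : Fin 2 → (FiniteAdeleRing (𝓞 F) F)ˣ)
    (v : HeightOneSpectrum (𝓞 F)) : borelBoxRadius 𝔫 t v ≠ 0 := by
  refine mul_ne_zero (mul_ne_zero ?_ (FiniteAdeleRing.valued_apply_ne_zero (R := 𝓞 F) (K := F) _ v))
    (inv_ne_zero (FiniteAdeleRing.valued_apply_ne_zero (R := 𝓞 F) (K := F) _ v))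
  rw [idealRadius]; exact WithZero.exp_ne_zero

/-- The radii are `1` for almost all `v` (`𝔫 ≠ 0`). [folklore] -/
theorem borelBoxRadius_eventually_eq_one {𝔫 : Ideal (𝓞 F)} (h𝔫 : 𝔫 ≠ 0)
    (t : Fin 2 → (FiniteAdeleRing (𝓞 F) F)ˣ) :
    ∀ᶠ v : HeightOneSpectrum (𝓞 F) in Filter.cofinite, borelBoxRadius 𝔫 t v = 1 := by
  filter_upwards [idealRadius_eventually_eq_one (K := F) h𝔫,
    FiniteAdeleRing.unitOrd_eventually_eq_zero (R := 𝓞 F) (K := F) (t 0),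
    FiniteAdeleRing.unitOrd_eventually_eq_zero (R := 𝓞 F) (K := F) (t 1)] with v h1 h2 h3
  rw [FiniteAdeleRing.unitOrd_eq_zero_iff] at h2 h3
  rw [borelBoxRadius, h1, h2, h3, inv_one, mul_one, mul_one]

/-- `|t₀|_v⁻¹ |b|_v |t₁|_v ≤ |𝔫|_v ↔ |b|_v ≤ |𝔫|_v |t₀|_v |t₁|_v⁻¹`. [folklore] -/
theorem conj_le_iff_le_borelBoxRadius (𝔫 : Ideal (𝓞 F)) (t : Fin 2 → (FiniteAdeleRing (𝓞 F) F)ˣ)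
    (v : HeightOneSpectrum (𝓞 F)) (x : WithZero (Multiplicative ℤ)) :
    (Valued.v (((t 0 : (FiniteAdeleRing (𝓞 F) F)ˣ) : FiniteAdeleRing (𝓞 F) F) v))⁻¹ * x *
        Valued.v (((t 1 : (FiniteAdeleRing (𝓞 F) F)ˣ) : FiniteAdeleRing (𝓞 F) F) v) ≤
        idealRadius F v 𝔫 ↔ x ≤ borelBoxRadius 𝔫 t v := by
  have h0 := FiniteAdeleRing.valued_apply_ne_zero (R := 𝓞 F) (K := F) (t 0) v
  have h1 := FiniteAdeleRing.valued_apply_ne_zero (R := 𝓞 F) (K := F) (t 1) v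
  rw [borelBoxRadius]
  set a := Valued.v (((t 0 : (FiniteAdeleRing (𝓞 F) F)ˣ) : FiniteAdeleRing (𝓞 F) F) v)
  set c := Valued.v (((t 1 : (FiniteAdeleRing (𝓞 F) F)ˣ) : FiniteAdeleRing (𝓞 F) F) v)
  set r := idealRadius F v 𝔫
  constructor
  · intro h
    calc x = a * (a⁻¹ * x * c) * c⁻¹ := by
          rw [mul_assoc a⁻¹ x c, ← mul_assoc, mul_inv_cancel₀ h0, one_mul,
            mul_assoc, mul_inv_cancel₀ h1, mul_one]
      _ ≤ a * r * c⁻¹ := by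
        refine mul_le_mul' (mul_le_mul' le_rfl h) le_rfl
      _ = r * a * c⁻¹ := by rw [mul_comm a r]
  · intro h
    calc a⁻¹ * x * c ≤ a⁻¹ * (r * a * c⁻¹) * c := mul_le_mul' (mul_le_mul' le_rfl h) le_rfl
      _ = r := by
          rw [mul_comm r a, mul_assoc a r, ← mul_assoc, inv_mul_cancel₀ h0, one_mul,
            mul_assoc, inv_mul_cancel₀ h1, mul_one]

variable {𝔫 : Ideal (𝓞 F)}

/-- The local entries of `d⁻¹ n(x) d` are controlled by `|t₀|_v⁻¹ |x|_v |t₁|_v`: if this is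
`≤ |𝔫|_v` then `(d⁻¹ n(x) d)_v ∈ K_v(|𝔫|_v)` (entries and inverse entries integral, congruence).
[folklore] -/
theorem conj_upperRightHom_mem_valuedCongruenceSubgroup (t : Fin 2 → (FiniteAdeleRing (𝓞 F) F)ˣ)
    (x : F) (v : HeightOneSpectrum (𝓞 F))
    (hx : (Valued.v (((t 0 : (FiniteAdeleRing (𝓞 F) F)ˣ) : FiniteAdeleRing (𝓞 F) F) v))⁻¹ *
      v.valuation F x * Valued.v (((t 1 : (FiniteAdeleRing (𝓞 F) F)ˣ) : FiniteAdeleRing (𝓞 F) F) v) ≤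
      idealRadius F v 𝔫) :
    (∀ i j : Fin 2, Valued.v ((localComponent 2 F v ((glDiagonal 2 (FiniteAdeleRing (𝓞 F) F) t)⁻¹ *
        globalEmbedding 2 F (Matrix.GeneralLinearGroup.upperRightHom x) *
        glDiagonal 2 (FiniteAdeleRing (𝓞 F) F) t) : Matrix (Fin 2) (Fin 2) (v.adicCompletion F)) i j) ≤ 1) ∧
    (∀ i j : Fin 2, Valued.v ((localComponent 2 F v ((glDiagonal 2 (FiniteAdeleRing (𝓞 F) F) t)⁻¹ *
        globalEmbedding 2 F (Matrix.GeneralLinearGroup.upperRightHom (-x)) *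
        glDiagonal 2 (FiniteAdeleRing (𝓞 F) F) t) : Matrix (Fin 2) (Fin 2) (v.adicCompletion F)) i j) ≤ 1) ∧
    localComponent 2 F v ((glDiagonal 2 (FiniteAdeleRing (𝓞 F) F) t)⁻¹ *
        globalEmbedding 2 F (Matrix.GeneralLinearGroup.upperRightHom x) *
        glDiagonal 2 (FiniteAdeleRing (𝓞 F) F) t) ∈
      valuedCongruenceSubgroup (Fin 2) (idealRadius F v 𝔫) := by
  have h0 := FiniteAdeleRing.valued_apply_ne_zero (R := 𝓞 F) (K := F) (t 0) v
  have h1 := FiniteAdeleRing.valued_apply_ne_zero (R := 𝓞 F) (K := F) (t 1) v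
  have hr1 : idealRadius F v 𝔫 ≤ 1 := idealRadius_le_one' (K := F) v 𝔫
  have hx' : (Valued.v (((t 0 : (FiniteAdeleRing (𝓞 F) F)ˣ) : FiniteAdeleRing (𝓞 F) F) v))⁻¹ *
      v.valuation F (-x) * Valued.v (((t 1 : (FiniteAdeleRing (𝓞 F) F)ˣ) : FiniteAdeleRing (𝓞 F) F) v) ≤
      idealRadius F v 𝔫 := by rw [Valuation.map_neg]; exact hx
  -- entries of `d⁻¹ n(y) d` at `v`, for `y = x, -x`
  have hent : ∀ y : F, (Valued.v (((t 0 : (FiniteAdeleRing (𝓞 F) F)ˣ) : FiniteAdeleRing (𝓞 F) F) v))⁻¹ *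
      v.valuation F y * Valued.v (((t 1 : (FiniteAdeleRing (𝓞 F) F)ˣ) : FiniteAdeleRing (𝓞 F) F) v) ≤
      idealRadius F v 𝔫 → ∀ i j : Fin 2,
      Valued.v ((localComponent 2 F v ((glDiagonal 2 (FiniteAdeleRing (𝓞 F) F) t)⁻¹ *
        globalEmbedding 2 F (Matrix.GeneralLinearGroup.upperRightHom y) *
        glDiagonal 2 (FiniteAdeleRing (𝓞 F) F) t) : Matrix (Fin 2) (Fin 2) (v.adicCompletion F)) i j) ≤
        if i = j then 1 else if i = 0 then idealRadius F v 𝔫 else 0 := by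
    intro y hy i j
    rw [valued_localComponent_conj_apply, Matrix.GeneralLinearGroup.upperRightHom_apply]
    fin_cases i <;> fin_cases j
    · simp [h0]
    · simpa using hy
    · simp
    · simp [h1]
  have hle : ∀ i j : Fin 2, (if i = j then (1 : WithZero (Multiplicative ℤ)) else
      if i = 0 then idealRadius F v 𝔫 else 0) ≤ 1 := by
    intro i j
    split_ifs
    · exact le_rfl
    · exact hr1
    · exact zero_le
  refine ⟨fun i j => (hent x hx i j).trans (hle i j), fun i j => (hent (-x) hx' i j).trans (hle i j),
    mem_valuedCongruenceSubgroup_iff.2 ⟨fun i j => (hent x hx i j).trans (hle i j), fun i j => ?_,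
      fun i j => ?_⟩⟩
  · have hGL : (localComponent 2 F v ((glDiagonal 2 (FiniteAdeleRing (𝓞 F) F) t)⁻¹ *
        globalEmbedding 2 F (Matrix.GeneralLinearGroup.upperRightHom x) *
        glDiagonal 2 (FiniteAdeleRing (𝓞 F) F) t))⁻¹ =
        localComponent 2 F v ((glDiagonal 2 (FiniteAdeleRing (𝓞 F) F) t)⁻¹ *
          globalEmbedding 2 F (Matrix.GeneralLinearGroup.upperRightHom (-x)) *
          glDiagonal 2 (FiniteAdeleRing (𝓞 F) F) t) := by
      rw [← map_inv, conj_inv_eq, ← map_inv (globalEmbedding 2 F), ← AddChar.map_neg_eq_inv]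
    rw [hGL]
    exact (hent (-x) hx' i j).trans (hle i j)
  · by_cases hij : i = j
    · subst hij
      rw [valued_localComponent_conj_sub_one_apply_diag, Matrix.GeneralLinearGroup.upperRightHom_apply]
      fin_cases i <;> simp
    · rw [localComponent_conj_sub_one_apply_of_ne v hij]
      refine (hent x hx i j).trans ?_
      rw [if_neg hij]
      split_ifs
      · exact le_rfl
      · exact zero_le

/-- **Stabilisers of `B(F)` on `GL₂(𝔸_F^∞)/K_f(𝔫)` at a neat level.**  For `𝔫 ≠ 0` NEAT
(`hneat`: the only `a ∈ F` with `a, a⁻¹` everywhere integral and `a ≡ 1 mod 𝔫` is `1`),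
`d = diag(t₀, t₁)` a diagonal finite idele and `c ∈ GL₂(𝒪̂_F)`: `γ = (a b; 0 e) ∈ B(F)` fixes
`d c K_f(𝔫)` iff `a = e = 1` and `|b|_v ≤ |𝔫|_v |t₀|_v |t₁|_v⁻¹` for all `v`.
[cite: Harder1987, §2] -/
theorem mem_orbitStabilizer_borel_iff
    (hneat : ∀ a : F, (∀ v : HeightOneSpectrum (𝓞 F), v.valuation F a ≤ 1) →
      (∀ v : HeightOneSpectrum (𝓞 F), v.valuation F a⁻¹ ≤ 1) →
      (∀ v : HeightOneSpectrum (𝓞 F), v.valuation F (a - 1) ≤ idealRadius F v 𝔫) → a = 1)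
    (t : Fin 2 → (FiniteAdeleRing (𝓞 F) F)ˣ) {c : FiniteAdelicGL 2 F}
    (hc : c ∈ glFiniteIntegralLevel 2 F) (γ : borel F) :
    γ ∈ TwistedQuotient.orbitStabilizer ((globalEmbedding 2 F).comp (borel F).subtype)
        ((principalCongruenceLevel 2 F 𝔫).comap (GLn.ofFinite 2 F))
        ((glDiagonal 2 (FiniteAdeleRing (𝓞 F) F) t * c : FiniteAdelicGL 2 F) :
          FiniteAdelicGL 2 F ⧸ (principalCongruenceLevel 2 F 𝔫).comap (GLn.ofFinite 2 F)) ↔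
      ((γ : GL (Fin 2) F) : Matrix (Fin 2) (Fin 2) F) 0 0 = 1 ∧
        ((γ : GL (Fin 2) F) : Matrix (Fin 2) (Fin 2) F) 1 1 = 1 ∧
        ∀ v : HeightOneSpectrum (𝓞 F),
          v.valuation F (((γ : GL (Fin 2) F) : Matrix (Fin 2) (Fin 2) F) 0 1) ≤ borelBoxRadius 𝔫 t v := by
  set d : FiniteAdelicGL 2 F := glDiagonal 2 (FiniteAdeleRing (𝓞 F) F) t with hd
  set L := (principalCongruenceLevel 2 F 𝔫).comap (GLn.ofFinite 2 F) with hL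
  -- Step 1: the stabiliser condition is `d⁻¹ ι(γ) d ∈ K_f(𝔫)`
  have step1 : γ ∈ TwistedQuotient.orbitStabilizer ((globalEmbedding 2 F).comp (borel F).subtype) L
      ((d * c : FiniteAdelicGL 2 F) : FiniteAdelicGL 2 F ⧸ L) ↔
      d⁻¹ * globalEmbedding 2 F (γ : GL (Fin 2) F) * d ∈ L := by
    rw [TwistedQuotient.mem_orbitStabilizer_iff, MonoidHom.comp_apply, Subgroup.coe_subtype,
      MulAction.Quotient.smul_coe, smul_eq_mul, eq_comm, QuotientGroup.eq, ← mul_assoc,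
      inv_mul_mul_mem_comap_principalCongruenceLevel_iff hc]
  rw [step1, mem_comap_principalCongruenceLevel_iff_localComponent]
  -- abbreviations for the entries
  have h10 : (((γ : borel F) : GL (Fin 2) F) : Matrix (Fin 2) (Fin 2) F) 1 0 = 0 :=
    (mem_borel_iff _).1 γ.2
  obtain ⟨hi10, hi00, hi11⟩ := borel_inv_apply γ
  have hinv : (d⁻¹ * globalEmbedding 2 F (γ : GL (Fin 2) F) * d)⁻¹ =
      d⁻¹ * globalEmbedding 2 F ((γ⁻¹ : borel F) : GL (Fin 2) F) * d := by
    rw [conj_inv_eq, Subgroup.coe_inv, map_inv]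
  constructor
  · intro h
    have hent : ∀ v (i j : Fin 2), Valued.v ((localComponent 2 F v (d⁻¹ *
        globalEmbedding 2 F (γ : GL (Fin 2) F) * d) : Matrix (Fin 2) (Fin 2) (v.adicCompletion F)) i j) ≤ 1 :=
      fun v => (mem_valuedCongruenceSubgroup_iff.1 (h v)).1
    have hent' : ∀ v (i j : Fin 2), Valued.v ((localComponent 2 F v (d⁻¹ *
        globalEmbedding 2 F ((γ⁻¹ : borel F) : GL (Fin 2) F) * d) :
          Matrix (Fin 2) (Fin 2) (v.adicCompletion F)) i j) ≤ 1 := fun v => by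
      rw [← hinv, ← map_inv]; exact (mem_valuedCongruenceSubgroup_iff.1 (h v)).2.1
    have hcong : ∀ v (i j : Fin 2), Valued.v (((localComponent 2 F v (d⁻¹ *
        globalEmbedding 2 F (γ : GL (Fin 2) F) * d) : Matrix (Fin 2) (Fin 2) (v.adicCompletion F)) - 1) i j) ≤
          idealRadius F v 𝔫 := fun v => (mem_valuedCongruenceSubgroup_iff.1 (h v)).2.2
    -- diagonal entries are `1`
    have hdiag : ∀ i : Fin 2, (((γ⁻¹ : borel F) : GL (Fin 2) F) : Matrix (Fin 2) (Fin 2) F) i i =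
        ((((γ : GL (Fin 2) F) : Matrix (Fin 2) (Fin 2) F) i i))⁻¹ →
        (((γ : GL (Fin 2) F) : Matrix (Fin 2) (Fin 2) F) i i) = 1 := by
      intro i hii
      refine hneat _ (fun v => ?_) (fun v => ?_) (fun v => ?_)
      · have := hent v i i
        rwa [valued_localComponent_conj_apply, mul_right_comm, inv_mul_cancel₀
          (FiniteAdeleRing.valued_apply_ne_zero (R := 𝓞 F) (K := F) _ v), one_mul] at this
      · have := hent' v i i
        rwa [valued_localComponent_conj_apply, mul_right_comm, inv_mul_cancel₀
          (FiniteAdeleRing.valued_apply_ne_zero (R := 𝓞 F) (K := F) _ v), one_mul, hii] at this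
      · have := hcong v i i
        rwa [valued_localComponent_conj_sub_one_apply_diag] at this
    refine ⟨hdiag 0 hi00, hdiag 1 hi11, fun v => ?_⟩
    have := hcong v 0 1
    rwa [localComponent_conj_sub_one_apply_of_ne v (by decide), valued_localComponent_conj_apply,
      conj_le_iff_le_borelBoxRadius] at this
  · rintro ⟨h00, h11, hb⟩ v
    have hγ := coe_eq_upperRightHom_of_diag_eq_one γ h00 h11
    set b := (((γ : GL (Fin 2) F) : Matrix (Fin 2) (Fin 2) F) 0 1) with hbdef
    have hγinv : ((γ⁻¹ : borel F) : GL (Fin 2) F) = Matrix.GeneralLinearGroup.upperRightHom (-b) := by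
      rw [Subgroup.coe_inv, hγ, AddChar.map_neg_eq_inv]
    -- entries of `n(±b)` conjugated, at `v`
    have hle1 : ∀ v, (Valued.v (((t 0 : (FiniteAdeleRing (𝓞 F) F)ˣ) : FiniteAdeleRing (𝓞 F) F) v))⁻¹ *
        v.valuation F b * Valued.v (((t 1 : (FiniteAdeleRing (𝓞 F) F)ˣ) : FiniteAdeleRing (𝓞 F) F) v) ≤
        idealRadius F v 𝔫 := fun v => (conj_le_iff_le_borelBoxRadius 𝔫 t v _).2 (hb v)
    have hmem := conj_upperRightHom_mem_valuedCongruenceSubgroup t b v (hle1 v)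
    rw [hγ]
    exact hmem.2.2

end ParallelWeight

end Literature.NumberTheory.Automorphic
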